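import Literature.ComputerArithmetic.Higham2002.Horner

/-!
# The compensated Horner scheme: EFT error identity and the `u + γ₂ₙ² cond(p, x)` accuracy bound
(Langlois–Louvet 2007; Graillat–Langlois–Louvet 2005)

HONEST FRAMING (ENGINES group, unit `eng-quad-4`, kernels lane of the `certquad` engine): the
kernels' trust bound ASSUMES the standard model `fl(a ∘ b) = (a ∘ b)(1 + δ)`, `|δ| ≤ u`, and, for
compensated evaluation, the ERROR-FREE TRANSFORMATIONS `a ∘ b = fl(a ∘ b) + y` with `y` computed
exactly (TwoSum / TwoProd). This file types and proves, in MODEL form exactly as `Horner.lean` and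
`Summation.lean` (the rounding errors are HYPOTHESES, discharged per format elsewhere), the textbook
consequences for the COMPENSATED HORNER SCHEME: the computed value is as accurate as Horner's rule
run in twice the working precision and rounded once. No hardware, vendor, timing or format claims.

Source read at the page: [LangloisLouvet2006] (arXiv:cs/0610122 = ARITH-18 2007, same numbering;
equation numbers below are those of the ARITH-18 print), which restates with proofs the results of
Graillat–Langlois–Louvet (Research Report 2005, their ref. [3]); cross-reference
[GraillatJezequel2020, §6.2 Algorithm 14 and Proposition 6.2] (the directed-rounding variant).

Typed and PROVED, for `p(x) = Σ_{i ≤ n} aᵢ xⁱ`, `p̃(t) = Σ_{i ≤ n} |aᵢ| tⁱ`, unit roundoff `u ≥ 0`: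

* `abs_hornerFl_perturbed_sub_sum_le(_gamma)` — LEMMA 1, eq. (7): Horner's rule applied to
  coefficients each carrying ONE relative rounding error (`p ⊕ q`: `(aᵢ + bᵢ)(1 + τᵢ)`) has forward
  error `≤ ((1 + u)^{2n+1} - 1) · Σ |eᵢ| |x|ⁱ ≤ γ₂ₙ₊₁ · (p+q)~(x)`
  [LangloisLouvet2006, §2.1 Lemma 1].
* THE EFT FOR HORNER (Algorithm 2 `EFTHorner`, THEOREM 3). The run is a TRACE `s, p, π, σ : ℕ → K`
  with `sₙ = aₙ` and, for `i < n`, the two EFT identities of [LangloisLouvet2006, §2.2 Theorem 2]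
  (= [OgitaRumpOishi2005]): `sᵢ₊₁ · x = pᵢ + πᵢ` (TwoProd) and `pᵢ + aᵢ = sᵢ + σᵢ` (TwoSum), taken
  as HYPOTHESES. Then
  - `eftHorner_add_sum_eq` — eq. (10): `s₀ + Σ_{i < n} (πᵢ + σᵢ) xⁱ = p(x)`, i.e.
    `p(x) = Horner(p, x) + (p_π + p_σ)(x)` EXACTLY — pure algebra, NO inequality hypotheses;
  - `sum_abs_pi_add_abs_sigma_le(_gamma)`, `sum_abs_pi_add_sigma_le_gamma` — eq. (11): with the
    Theorem-2 error bounds `|πᵢ| ≤ u |sᵢ₊₁ x|`, `|σᵢ| ≤ u |pᵢ + aᵢ|`,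
    `Σ_{i<n} (|πᵢ| + |σᵢ|) |x|ⁱ ≤ ((1 + u)^{2n} - 1) p̃(|x|) ≤ γ₂ₙ p̃(|x|)` (hence the printed
    `(p_π + p_σ)~(x) ≤ γ₂ₙ p̃(x)`); `abs_eftHorner_le`: `|s₀| ≤ (1 + u)^{2n} p̃(|x|)` (the standard
    analysis of Horner's rule, [Higham2002ASNA, §5.1 p. 95], in product form — the ingredient of
    the printed proof of eq. (11)).
* THE COMPENSATED HORNER SCHEME (Algorithm 3 `CompHorner`): `ĉ = Horner(p_π ⊕ p_σ, x)`
  (`compHornerCorr`: coefficients `(πᵢ + σᵢ)(1 + τᵢ)`, then Horner in the model on these `n`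
  coefficients), `res = (s₀ + ĉ)(1 + η)` (`compHornerRes`).
  - `abs_compHornerRes_sub_sum_le(_gamma)` — THEOREM 4, eq. (12):
    `|res - p(x)| ≤ u |p(x)| + ((1 + u)^{2n} - 1)² p̃(|x|) ≤ u |p(x)| + γ₂ₙ² p̃(|x|)`;
  - `abs_compHornerRes_sub_sum_div_le` — eq. (14): `|res - p(x)| / |p(x)| ≤ u + γ₂ₙ² cond(p, x)`;
  - `abs_compHornerCorr_sub_le_gamma_sq` — REMARK 1, eq. (13): `|ĉ - c| ≤ γ₂ₙ² p̃(|x|)`,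
    `c = (p_π + p_σ)(x)`;
  - `abs_compHornerCorr_sub_lt_of_cond_lt` — the real-arithmetic core of THEOREM 7: if
    `cond(p, x) < (1 - u)/(2 + u) · u · γ₂ₙ⁻²` (eq. (15)) then `|ĉ - c| < (u/2) |res|`, which is the
    hypothesis of [LangloisLouvet2006, §3.2 Lemma 6]; the remaining step "hence `res` is a FAITHFUL
    ROUNDING of `p(x)`" is Lemma 5 (= Rump–Ogita–Oishi), a statement about the floating-point
    FORMAT, and is NOT made here;
  - `abs_res_sub_sum_le_of_twoSum` — REMARK 2 eq. (18) / proof of THEOREM 9: if the last addition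
    is an EFT,
    `res + e = s₀ + ĉ`, then `|res - p(x)| ≤ |ĉ - c| + |e|` (the dynamic bound's starting point).

PARAMETERS. `u` is the unit roundoff of round-to-nearest (the EFTs of Theorem 2 need round-to-
nearest and no underflow; those provisos live in the discharge of the hypotheses, cf. the
FORMAT-level EFT theorems `twoSum_correct` / `twoProdFMA_correct` of
`Literature/ComputerArithmetic/BoldoJeannerodMelquiondMuller2023/{TwoSum,TwoProd}.lean`, which
produce exactly the identities assumed here over `ℚ`). Degree `n` means `2n` rounded operations in
`EFTHorner`, `n` coefficient additions + `2(n-1)` Horner operations for `ĉ`, and one final addition.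
Ordered field `K` arbitrary (`ℚ` for exact replay of a logged run, `ℝ` for the textbook).

ENCODING. As in `Horner.lean`, inductions peel off the LAST Horner step `i = 0`
(`p(x) = x · q(x) + a₀`, `Higham2002.sum_mul_pow_succ_eq`) and recurse on the shifted sequences
`a ∘ succ, s ∘ succ, …`; the trace form (sequences + defining identities as hypotheses) is literally
Algorithm 2 line by line and makes eq. (10) hypothesis-free algebra. The product form
`(1 + u)^k - 1` is proved first (it is what the inductions give, with the geometric-sum identity
`u · Σ_{m<2n} (1 + u)^m = (1 + u)^{2n} - 1` behind eq. (11));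
`Higham2002.one_add_pow_sub_one_le_gamma` converts to the printed `γ` form. In Theorem 4 we use
`(1 + u) · ((1 + u)^{2n-1} - 1) ≤ (1 + u)^{2n} - 1` in place of the print's
`(1 + u) γ₂ₙ₋₁ ≤ γ₂ₙ` — the same step in product form, so no `2n - 1` (truncated subtraction)
appears in any statement: the correction polynomial is handled through
`hornerFlTrunc` (Horner over the first `m` coefficients, the empty polynomial evaluating to `0`).

NOT HERE: the faithful-rounding conclusions themselves (Lemma 5, Lemma 6, Theorems 7 and 9 first
items: FORMAT statements); the floating-point-computable bounds `γ̂ₖ`, `α̂`, `β̂` of eqs. (4), (5),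
(17), (19) (they assert facts about `fl` of specific expressions); the second display of Lemma 1,
eq. (8) (it uses the `fl(a ∘ b) = (a ∘ b)/(1 + ε₂)` form of the model); FMA-based and `K`-fold
compensated variants; the directed-rounding error bound of [GraillatJezequel2020, §6.2
Proposition 6.2] (Algorithm 14 with `TwoProdFMA` / `FastTwoSum`; constants `2u` in place of `u`).
-/

namespace Literature.ComputerArithmetic.LangloisLouvet2006

open Finset Literature.ComputerArithmetic.Higham2002

variable {K : Type*} [Field K] [LinearOrder K] [IsStrictOrderedRing K]

/-! ## Lemma 1: Horner's rule on coefficients that carry one rounding error (`p ⊕ q`) -/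

/-- LEMMA 1 (model form, product version). Horner's rule in the rounding-error model applied to the
ROUNDED coefficients `eᵢ(1 + τᵢ)` (`|τᵢ| ≤ u`; for `p ⊕ q` take `eᵢ = aᵢ + bᵢ`), with Horner
roundings `|εᵢ|, |δᵢ| ≤ u`, degree `n`:
`|Horner(p ⊕ q, x) - (p+q)(x)| ≤ ((1 + u)^{2n+1} - 1) · Σ_{i ≤ n} |eᵢ| |x|ⁱ`.
[cite: LangloisLouvet2006, §2.1 Lemma 1 eq. (7)] [cite: Higham2002ASNA, §5.1 p. 95] -/
theorem abs_hornerFl_perturbed_sub_sum_le {u : K} (hu : 0 ≤ u) (x : K) (n : ℕ) (e τ ε δ : ℕ → K)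
    (hτ : ∀ k, |τ k| ≤ u) (hε : ∀ k, |ε k| ≤ u) (hδ : ∀ k, |δ k| ≤ u) :
    |hornerFl x (fun i => e i * (1 + τ i)) ε δ n - ∑ i ∈ range (n + 1), e i * x ^ i|
      ≤ ((1 + u) ^ (2 * n + 1) - 1) * ∑ i ∈ range (n + 1), |e i| * |x| ^ i := by
  set S := ∑ i ∈ range (n + 1), |e i| * |x| ^ i with hS
  have hS0 : 0 ≤ S := Finset.sum_nonneg fun _ _ => by positivity
  have h1 := abs_hornerFl_sub_sum_le hu x n (fun i => e i * (1 + τ i)) ε δ hε hδ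
  have hcoef : ∀ i, |e i * (1 + τ i)| ≤ (1 + u) * |e i| := fun i => by
    have h1t : |1 + τ i| ≤ 1 + u := by
      have := abs_le.mp (hτ i); rw [abs_le]; constructor <;> linarith
    rw [abs_mul, mul_comm (1 + u)]
    exact mul_le_mul_of_nonneg_left h1t (abs_nonneg _)
  have h2 : ∑ i ∈ range (n + 1), |e i * (1 + τ i)| * |x| ^ i ≤ (1 + u) * S := by
    rw [hS, Finset.mul_sum]
    refine Finset.sum_le_sum fun i _ => ?_
    rw [← mul_assoc]
    exact mul_le_mul_of_nonneg_right (hcoef i) (by positivity)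
  have h3 : |∑ i ∈ range (n + 1), e i * (1 + τ i) * x ^ i - ∑ i ∈ range (n + 1), e i * x ^ i|
      ≤ u * S := by
    rw [← Finset.sum_sub_distrib, hS, Finset.mul_sum]
    refine le_trans (Finset.abs_sum_le_sum_abs _ _) (Finset.sum_le_sum fun i _ => ?_)
    rw [show e i * (1 + τ i) * x ^ i - e i * x ^ i = τ i * (e i * x ^ i) by ring, abs_mul,
      abs_mul, abs_pow]
    exact mul_le_mul_of_nonneg_right (hτ i) (by positivity)
  have hq : 0 ≤ (1 + u) ^ (2 * n) - 1 := by
    have := one_le_pow₀ (M₀ := K) (a := 1 + u) (by linarith) (n := 2 * n); linarith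
  calc |hornerFl x (fun i => e i * (1 + τ i)) ε δ n - ∑ i ∈ range (n + 1), e i * x ^ i|
      = |(hornerFl x (fun i => e i * (1 + τ i)) ε δ n
            - ∑ i ∈ range (n + 1), e i * (1 + τ i) * x ^ i)
          + (∑ i ∈ range (n + 1), e i * (1 + τ i) * x ^ i - ∑ i ∈ range (n + 1), e i * x ^ i)| := by
        rw [sub_add_sub_cancel]
    _ ≤ ((1 + u) ^ (2 * n) - 1) * ∑ i ∈ range (n + 1), |e i * (1 + τ i)| * |x| ^ i + u * S :=
        le_trans (abs_add_le _ _) (add_le_add h1 h3)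
    _ ≤ ((1 + u) ^ (2 * n) - 1) * ((1 + u) * S) + u * S :=
        add_le_add (mul_le_mul_of_nonneg_left h2 hq) le_rfl
    _ = ((1 + u) ^ (2 * n + 1) - 1) * S := by rw [pow_succ]; ring

/-- LEMMA 1 (model form, `γ` version): with `(2n+1) u < 1`,
`|Horner(p ⊕ q, x) - (p+q)(x)| ≤ γ₂ₙ₊₁ · (p+q)~(x)`, `(p+q)~(x) = Σ |aᵢ + bᵢ| |x|ⁱ`.
[cite: LangloisLouvet2006, §2.1 Lemma 1 eq. (7)] -/
theorem abs_hornerFl_perturbed_sub_sum_le_gamma {u : K} (hu : 0 ≤ u) {n : ℕ}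
    (hn : ((2 * n + 1 : ℕ) : K) * u < 1) (x : K) (e τ ε δ : ℕ → K) (hτ : ∀ k, |τ k| ≤ u)
    (hε : ∀ k, |ε k| ≤ u) (hδ : ∀ k, |δ k| ≤ u) :
    |hornerFl x (fun i => e i * (1 + τ i)) ε δ n - ∑ i ∈ range (n + 1), e i * x ^ i|
      ≤ gamma u (2 * n + 1) * ∑ i ∈ range (n + 1), |e i| * |x| ^ i :=
  le_trans (abs_hornerFl_perturbed_sub_sum_le hu x n e τ ε δ hτ hε hδ)
    (mul_le_mul_of_nonneg_right (one_add_pow_sub_one_le_gamma hu hn)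
      (Finset.sum_nonneg fun _ _ => by positivity))

/-! ## Algorithm 2 `EFTHorner` and Theorem 3: the error of Horner's rule is `(p_π + p_σ)(x)` -/

omit [LinearOrder K] [IsStrictOrderedRing K] in
/-- THEOREM 3, eq. (10) — `EFTHorner` IS AN ERROR-FREE TRANSFORMATION. Let the trace of Algorithm 2
satisfy `sₙ = aₙ` and, for every `i < n`, the EFT identities of Theorem 2:
`sᵢ₊₁ · x = pᵢ + πᵢ` (`[pᵢ, πᵢ] = TwoProd(sᵢ₊₁, x)`) and `pᵢ + aᵢ = sᵢ + σᵢ`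
(`[sᵢ, σᵢ] = TwoSum(pᵢ, aᵢ)`). Then EXACTLY
`s₀ + Σ_{i<n} (πᵢ + σᵢ) xⁱ = Σ_{i ≤ n} aᵢ xⁱ`, i.e. `p(x) = Horner(p, x) + (p_π + p_σ)(x)`.
Pure algebra: no size hypothesis on the errors is used.
[cite: LangloisLouvet2006, §2.3 Theorem 3 eq. (10)] -/
theorem eftHorner_add_sum_eq (x : K) :
    ∀ (n : ℕ) (a s p π σ : ℕ → K), s n = a n → (∀ i < n, s (i + 1) * x = p i + π i) →
      (∀ i < n, p i + a i = s i + σ i) →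
      s 0 + ∑ i ∈ range n, (π i + σ i) * x ^ i = ∑ i ∈ range (n + 1), a i * x ^ i
  | 0, a, s, p, π, σ, hsn, _, _ => by simp [hsn]
  | n + 1, a, s, p, π, σ, hsn, hprod, hsum => by
      have ih := eftHorner_add_sum_eq x n (fun i => a (i + 1)) (fun i => s (i + 1))
        (fun i => p (i + 1)) (fun i => π (i + 1)) (fun i => σ (i + 1)) hsn
        (fun i hi => hprod (i + 1) (by omega)) (fun i hi => hsum (i + 1) (by omega))
      have h0p : s (0 + 1) * x = p 0 + π 0 := hprod 0 (by omega)
      have h0s : p 0 + a 0 = s 0 + σ 0 := hsum 0 (by omega)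
      simp only [zero_add] at h0p
      rw [sum_mul_pow_succ_eq a x n, Finset.sum_range_succ' (fun i => (π i + σ i) * x ^ i) n]
      have hshift : ∑ i ∈ range n, (π (i + 1) + σ (i + 1)) * x ^ (i + 1)
          = (∑ i ∈ range n, (π (i + 1) + σ (i + 1)) * x ^ i) * x := by
        rw [Finset.sum_mul]
        exact Finset.sum_congr rfl fun i _ => by ring
      rw [hshift, pow_zero, mul_one]
      linear_combination x * ih - h0p - h0s

/-- ONE `EFTHorner` STEP, size bookkeeping: from `S · x = p₀ + π₀`, `p₀ + a₀ = s₀ + σ₀`,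
`|π₀| ≤ u |S x|`, `|σ₀| ≤ u |p₀ + a₀|` and `|S| ≤ Q` we get `|s₀| ≤ (1 + u)² (Q |x| + |a₀|)` and
`|π₀| + |σ₀| ≤ ((1 + u)² - 1) Q |x| + u |a₀|`.
[cite: LangloisLouvet2006, §2.3 Theorem 3 eq. (11)] -/
theorem eftHorner_step {u S x p₀ π₀ a₀ s₀ σ₀ Q : K} (hu : 0 ≤ u) (hprod : S * x = p₀ + π₀)
    (hsum : p₀ + a₀ = s₀ + σ₀) (hπ : |π₀| ≤ u * |S * x|) (hσ : |σ₀| ≤ u * |p₀ + a₀|)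
    (hS : |S| ≤ Q) :
    |s₀| ≤ (1 + u) ^ 2 * (Q * |x| + |a₀|)
      ∧ |π₀| + |σ₀| ≤ ((1 + u) ^ 2 - 1) * (Q * |x|) + u * |a₀| := by
  have hQ0 : 0 ≤ Q := le_trans (abs_nonneg _) hS
  have hx0 := abs_nonneg x
  have ha0 := abs_nonneg a₀
  have hSx : |S * x| ≤ Q * |x| := by
    rw [abs_mul]; exact mul_le_mul_of_nonneg_right hS hx0
  have hπ' : |π₀| ≤ u * (Q * |x|) := le_trans hπ (mul_le_mul_of_nonneg_left hSx hu)
  have hp : |p₀| ≤ (1 + u) * (Q * |x|) := by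
    rw [eq_sub_of_add_eq hprod.symm]
    calc |S * x - π₀| ≤ |S * x| + |π₀| := abs_sub _ _
      _ ≤ Q * |x| + u * (Q * |x|) := add_le_add hSx hπ'
      _ = (1 + u) * (Q * |x|) := by ring
  have hpa : |p₀ + a₀| ≤ (1 + u) * (Q * |x|) + |a₀| :=
    le_trans (abs_add_le _ _) (add_le_add hp le_rfl)
  have hσ' : |σ₀| ≤ u * ((1 + u) * (Q * |x|) + |a₀|) :=
    le_trans hσ (mul_le_mul_of_nonneg_left hpa hu)
  refine ⟨?_, ?_⟩
  · rw [eq_sub_of_add_eq hsum.symm]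
    calc |p₀ + a₀ - σ₀| ≤ |p₀ + a₀| + |σ₀| := abs_sub _ _
      _ ≤ ((1 + u) * (Q * |x|) + |a₀|) + u * ((1 + u) * (Q * |x|) + |a₀|) := add_le_add hpa hσ'
      _ = (1 + u) ^ 2 * (Q * |x|) + (1 + u) * |a₀| := by ring
      _ ≤ (1 + u) ^ 2 * (Q * |x|) + (1 + u) ^ 2 * |a₀| := by
          have : (1 + u) * |a₀| ≤ (1 + u) ^ 2 * |a₀| :=
            mul_le_mul_of_nonneg_right (by nlinarith) ha0
          linarith
      _ = (1 + u) ^ 2 * (Q * |x| + |a₀|) := by ring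
  · calc |π₀| + |σ₀| ≤ u * (Q * |x|) + u * ((1 + u) * (Q * |x|) + |a₀|) := add_le_add hπ' hσ'
      _ = ((1 + u) ^ 2 - 1) * (Q * |x|) + u * |a₀| := by ring

/-- SIZE OF THE HORNER VALUE along the `EFTHorner` trace (the standard analysis of Horner's rule in
product form, the ingredient of the printed proof of eq. (11)): under the EFT identities and the
Theorem-2 bounds `|πᵢ| ≤ u |sᵢ₊₁ x|`, `|σᵢ| ≤ u |pᵢ + aᵢ|`,
`|s₀| = |Horner(p, x)| ≤ (1 + u)^{2n} · p̃(|x|)`.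
[cite: LangloisLouvet2006, §2.3 proof of Theorem 3] [cite: Higham2002ASNA, §5.1 p. 95] -/
theorem abs_eftHorner_le {u : K} (hu : 0 ≤ u) (x : K) :
    ∀ (n : ℕ) (a s p π σ : ℕ → K), s n = a n → (∀ i < n, s (i + 1) * x = p i + π i) →
      (∀ i < n, p i + a i = s i + σ i) → (∀ i < n, |π i| ≤ u * |s (i + 1) * x|) →
      (∀ i < n, |σ i| ≤ u * |p i + a i|) →
      |s 0| ≤ (1 + u) ^ (2 * n) * ∑ i ∈ range (n + 1), |a i| * |x| ^ i
  | 0, a, s, p, π, σ, hsn, _, _, _, _ => by simp [hsn]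
  | n + 1, a, s, p, π, σ, hsn, hprod, hsum, hπ, hσ => by
      have ih := abs_eftHorner_le hu x n (fun i => a (i + 1)) (fun i => s (i + 1))
        (fun i => p (i + 1)) (fun i => π (i + 1)) (fun i => σ (i + 1)) hsn
        (fun i hi => hprod (i + 1) (by omega)) (fun i hi => hsum (i + 1) (by omega))
        (fun i hi => hπ (i + 1) (by omega)) (fun i hi => hσ (i + 1) (by omega))
      set qt := ∑ i ∈ range (n + 1), |a (i + 1)| * |x| ^ i with hqt
      have hqt0 : 0 ≤ qt := Finset.sum_nonneg fun _ _ => by positivity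
      have h0p : s (0 + 1) * x = p 0 + π 0 := hprod 0 (by omega)
      have h0π : |π 0| ≤ u * |s (0 + 1) * x| := hπ 0 (by omega)
      simp only [zero_add] at h0p h0π
      obtain ⟨hstep, -⟩ := eftHorner_step hu h0p (hsum 0 (by omega)) h0π (hσ 0 (by omega)) ih
      rw [sum_mul_pow_succ_eq (fun i => |a i|) |x| n]
      have hpow : (1 + u) ^ (2 * (n + 1)) = (1 + u) ^ 2 * (1 + u) ^ (2 * n) := by
        rw [show 2 * (n + 1) = 2 + 2 * n by ring, pow_add]
      have hge1 : 1 ≤ (1 + u) ^ (2 * n) := one_le_pow₀ (by linarith)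
      calc |s 0| ≤ (1 + u) ^ 2 * ((1 + u) ^ (2 * n) * qt * |x| + |a 0|) := hstep
        _ ≤ (1 + u) ^ 2 * ((1 + u) ^ (2 * n) * (qt * |x| + |a 0|)) := by
            refine mul_le_mul_of_nonneg_left ?_ (sq_nonneg _)
            have : |a 0| ≤ (1 + u) ^ (2 * n) * |a 0| := le_mul_of_one_le_left (abs_nonneg _) hge1
            linarith
        _ = (1 + u) ^ (2 * (n + 1)) * (qt * |x| + |a 0|) := by rw [hpow]; ring

/-- THEOREM 3, eq. (11) (model form, product version, coefficientwise): under the EFT identities and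
the Theorem-2 bounds, `Σ_{i<n} (|πᵢ| + |σᵢ|) |x|ⁱ ≤ ((1 + u)^{2n} - 1) · p̃(|x|)` — i.e.
`p̃_π(|x|) + p̃_σ(|x|)`, which dominates the printed `(p_π + p_σ)~(|x|)`. Behind it:
`u · Σ_{m<2n} (1 + u)^m = (1 + u)^{2n} - 1`. [cite: LangloisLouvet2006, §2.3 Theorem 3 eq. (11)] -/
theorem sum_abs_pi_add_abs_sigma_le {u : K} (hu : 0 ≤ u) (x : K) :
    ∀ (n : ℕ) (a s p π σ : ℕ → K), s n = a n → (∀ i < n, s (i + 1) * x = p i + π i) →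
      (∀ i < n, p i + a i = s i + σ i) → (∀ i < n, |π i| ≤ u * |s (i + 1) * x|) →
      (∀ i < n, |σ i| ≤ u * |p i + a i|) →
      ∑ i ∈ range n, (|π i| + |σ i|) * |x| ^ i
        ≤ ((1 + u) ^ (2 * n) - 1) * ∑ i ∈ range (n + 1), |a i| * |x| ^ i
  | 0, a, s, p, π, σ, _, _, _, _, _ => by simp
  | n + 1, a, s, p, π, σ, hsn, hprod, hsum, hπ, hσ => by
      have ih := sum_abs_pi_add_abs_sigma_le hu x n (fun i => a (i + 1)) (fun i => s (i + 1))
        (fun i => p (i + 1)) (fun i => π (i + 1)) (fun i => σ (i + 1)) hsn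
        (fun i hi => hprod (i + 1) (by omega)) (fun i hi => hsum (i + 1) (by omega))
        (fun i hi => hπ (i + 1) (by omega)) (fun i hi => hσ (i + 1) (by omega))
      have hS := abs_eftHorner_le hu x n (fun i => a (i + 1)) (fun i => s (i + 1))
        (fun i => p (i + 1)) (fun i => π (i + 1)) (fun i => σ (i + 1)) hsn
        (fun i hi => hprod (i + 1) (by omega)) (fun i hi => hsum (i + 1) (by omega))
        (fun i hi => hπ (i + 1) (by omega)) (fun i hi => hσ (i + 1) (by omega))
      set qt := ∑ i ∈ range (n + 1), |a (i + 1)| * |x| ^ i with hqt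
      have hqt0 : 0 ≤ qt := Finset.sum_nonneg fun _ _ => by positivity
      have h0p : s (0 + 1) * x = p 0 + π 0 := hprod 0 (by omega)
      have h0π : |π 0| ≤ u * |s (0 + 1) * x| := hπ 0 (by omega)
      simp only [zero_add] at h0p h0π
      obtain ⟨-, hstep⟩ := eftHorner_step hu h0p (hsum 0 (by omega)) h0π (hσ 0 (by omega)) hS
      rw [Finset.sum_range_succ' (fun i => (|π i| + |σ i|) * |x| ^ i) n,
        sum_mul_pow_succ_eq (fun i => |a i|) |x| n]
      have hshift : ∑ i ∈ range n, (|π (i + 1)| + |σ (i + 1)|) * |x| ^ (i + 1)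
          = (∑ i ∈ range n, (|π (i + 1)| + |σ (i + 1)|) * |x| ^ i) * |x| := by
        rw [Finset.sum_mul]
        exact Finset.sum_congr rfl fun i _ => by ring
      rw [hshift, pow_zero, mul_one]
      have hx0 := abs_nonneg x
      have ha0 := abs_nonneg (a 0)
      have hpow : (1 + u) ^ (2 * (n + 1)) = (1 + u) ^ (2 * n) * (1 + u) ^ 2 := by
        rw [show 2 * (n + 1) = 2 * n + 2 by ring, pow_add]
      have hge1 : 1 ≤ (1 + u) ^ (2 * n) := one_le_pow₀ (by linarith)
      have hu_le : u ≤ (1 + u) ^ (2 * n) * (1 + u) ^ 2 - 1 := by nlinarith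
      calc (∑ i ∈ range n, (|π (i + 1)| + |σ (i + 1)|) * |x| ^ i) * |x| + (|π 0| + |σ 0|)
          ≤ ((1 + u) ^ (2 * n) - 1) * qt * |x|
              + (((1 + u) ^ 2 - 1) * ((1 + u) ^ (2 * n) * qt * |x|) + u * |a 0|) :=
            add_le_add (mul_le_mul_of_nonneg_right ih hx0) hstep
        _ = ((1 + u) ^ (2 * n) * (1 + u) ^ 2 - 1) * (qt * |x|) + u * |a 0| := by ring
        _ ≤ ((1 + u) ^ (2 * n) * (1 + u) ^ 2 - 1) * (qt * |x|)
              + ((1 + u) ^ (2 * n) * (1 + u) ^ 2 - 1) * |a 0| :=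
            add_le_add le_rfl (mul_le_mul_of_nonneg_right hu_le ha0)
        _ = ((1 + u) ^ (2 * (n + 1)) - 1) * (qt * |x| + |a 0|) := by rw [hpow]; ring

/-- THEOREM 3, eq. (11), `γ` version: with `2n · u < 1`,
`p̃_π(|x|) + p̃_σ(|x|) = Σ_{i<n} (|πᵢ| + |σᵢ|) |x|ⁱ ≤ γ₂ₙ · p̃(|x|)`.
[cite: LangloisLouvet2006, §2.3 Theorem 3 eq. (11)] -/
theorem sum_abs_pi_add_abs_sigma_le_gamma {u : K} (hu : 0 ≤ u) {n : ℕ}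
    (hn : ((2 * n : ℕ) : K) * u < 1) (x : K) (a s p π σ : ℕ → K) (hsn : s n = a n)
    (hprod : ∀ i < n, s (i + 1) * x = p i + π i) (hsum : ∀ i < n, p i + a i = s i + σ i)
    (hπ : ∀ i < n, |π i| ≤ u * |s (i + 1) * x|) (hσ : ∀ i < n, |σ i| ≤ u * |p i + a i|) :
    ∑ i ∈ range n, (|π i| + |σ i|) * |x| ^ i
      ≤ gamma u (2 * n) * ∑ i ∈ range (n + 1), |a i| * |x| ^ i :=
  le_trans (sum_abs_pi_add_abs_sigma_le hu x n a s p π σ hsn hprod hsum hπ hσ)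
    (mul_le_mul_of_nonneg_right (one_add_pow_sub_one_le_gamma hu hn)
      (Finset.sum_nonneg fun _ _ => by positivity))

/-- THEOREM 3, eq. (11) as printed: `(p_π + p_σ)~(|x|) = Σ_{i<n} |πᵢ + σᵢ| |x|ⁱ ≤ γ₂ₙ · p̃(|x|)`.
[cite: LangloisLouvet2006, §2.3 Theorem 3 eq. (11)] -/
theorem sum_abs_pi_add_sigma_le_gamma {u : K} (hu : 0 ≤ u) {n : ℕ}
    (hn : ((2 * n : ℕ) : K) * u < 1) (x : K) (a s p π σ : ℕ → K) (hsn : s n = a n)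
    (hprod : ∀ i < n, s (i + 1) * x = p i + π i) (hsum : ∀ i < n, p i + a i = s i + σ i)
    (hπ : ∀ i < n, |π i| ≤ u * |s (i + 1) * x|) (hσ : ∀ i < n, |σ i| ≤ u * |p i + a i|) :
    ∑ i ∈ range n, |π i + σ i| * |x| ^ i
      ≤ gamma u (2 * n) * ∑ i ∈ range (n + 1), |a i| * |x| ^ i :=
  le_trans (Finset.sum_le_sum fun i _ =>
      mul_le_mul_of_nonneg_right (abs_add_le _ _) (by positivity))
    (sum_abs_pi_add_abs_sigma_le_gamma hu hn x a s p π σ hsn hprod hsum hπ hσ)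

/-! ## Algorithm 3 `CompHorner` and Theorem 4 -/

/-- Horner's rule in the rounding-error model over the FIRST `m` coefficients `r₀, …, r_{m-1}`
(a polynomial of degree `m - 1`, `2(m-1)` roundings); the empty polynomial (`m = 0`) evaluates to
`0` with no operation. Used for `Horner(p_π ⊕ p_σ, x)`, whose coefficient list has length `n`.
[cite: LangloisLouvet2006, §2.4 Algorithm 3] -/
def hornerFlTrunc (x : K) (r ε δ : ℕ → K) : ℕ → K
  | 0 => 0
  | m + 1 => hornerFl x r ε δ m

/-- ALGORITHM 3, line 2, in the model: the computed correcting term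
`ĉ = Horner(p_π ⊕ p_σ, x)` — coefficients `(πᵢ + σᵢ)(1 + τᵢ)` (one rounding each, `|τᵢ| ≤ u`),
then Horner's rule with roundings `εᵢ, δᵢ` on these `n` coefficients.
[cite: LangloisLouvet2006, §2.4 Algorithm 3] [cite: GraillatJezequel2020, §6.2 Algorithm 14] -/
def compHornerCorr (x : K) (π σ τ ε δ : ℕ → K) (n : ℕ) : K :=
  hornerFlTrunc x (fun i => (π i + σ i) * (1 + τ i)) ε δ n

/-- ALGORITHM 3, line 3, in the model: the compensated result `res = s₀ ⊕ ĉ = (s₀ + ĉ)(1 + η)`,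
`s₀ = Horner(p, x)` the first output of `EFTHorner`.
[cite: LangloisLouvet2006, §2.4 Algorithm 3] [cite: GraillatJezequel2020, §6.2 Algorithm 14] -/
def compHornerRes (x s₀ : K) (π σ τ ε δ : ℕ → K) (η : K) (n : ℕ) : K :=
  (s₀ + compHornerCorr x π σ τ ε δ n) * (1 + η)

/-- ERROR OF THE CORRECTING TERM (Lemma 1 applied to the `n` coefficients of `p_π ⊕ p_σ`, in the
product form used by Theorem 4): with `|τᵢ|, |εᵢ|, |δᵢ| ≤ u`,
`(1 + u) · |Horner((eᵢ(1 + τᵢ))ᵢ, x) - Σ_{i<n} eᵢ xⁱ| ≤ ((1 + u)^{2n} - 1) · Σ_{i<n} |eᵢ| |x|ⁱ`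
(the print's `(1 + u) γ₂ₙ₋₁ ≤ γ₂ₙ` step, as `(1 + u)((1 + u)^{2n-1} - 1) ≤ (1 + u)^{2n} - 1`).
[cite: LangloisLouvet2006, §3.1 Theorem 4] [cite: LangloisLouvet2006, §2.1 Lemma 1 eq. (7)] -/
theorem one_add_mul_abs_hornerFlTrunc_sub_sum_le {u : K} (hu : 0 ≤ u) (x : K) (n : ℕ)
    (e τ ε δ : ℕ → K) (hτ : ∀ k, |τ k| ≤ u) (hε : ∀ k, |ε k| ≤ u) (hδ : ∀ k, |δ k| ≤ u) :
    (1 + u) * |hornerFlTrunc x (fun i => e i * (1 + τ i)) ε δ n - ∑ i ∈ range n, e i * x ^ i|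
      ≤ ((1 + u) ^ (2 * n) - 1) * ∑ i ∈ range n, |e i| * |x| ^ i := by
  cases n with
  | zero => simp [hornerFlTrunc]
  | succ m =>
      have h := abs_hornerFl_perturbed_sub_sum_le hu x m e τ ε δ hτ hε hδ
      have hS0 : 0 ≤ ∑ i ∈ range (m + 1), |e i| * |x| ^ i :=
        Finset.sum_nonneg fun _ _ => by positivity
      simp only [hornerFlTrunc]
      calc (1 + u) * |hornerFl x (fun i => e i * (1 + τ i)) ε δ m
              - ∑ i ∈ range (m + 1), e i * x ^ i|
          ≤ (1 + u) * (((1 + u) ^ (2 * m + 1) - 1) * ∑ i ∈ range (m + 1), |e i| * |x| ^ i) :=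
            mul_le_mul_of_nonneg_left h (by linarith)
        _ = ((1 + u) ^ (2 * (m + 1)) - 1 - u) * ∑ i ∈ range (m + 1), |e i| * |x| ^ i := by
            rw [show 2 * (m + 1) = 2 * m + 1 + 1 by ring, pow_succ _ (2 * m + 1)]; ring
        _ ≤ ((1 + u) ^ (2 * (m + 1)) - 1) * ∑ i ∈ range (m + 1), |e i| * |x| ^ i :=
            mul_le_mul_of_nonneg_right (by linarith) hS0

/-- THEOREM 4, eq. (12) (model form, product version) — ACCURACY OF THE COMPENSATED HORNER SCHEME:
under the `EFTHorner` identities and Theorem-2 bounds (`|πᵢ| ≤ u |sᵢ₊₁ x|`, `|σᵢ| ≤ u |pᵢ + aᵢ|`)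
and `|τᵢ|, |εᵢ|, |δᵢ|, |η| ≤ u`,
`|res - p(x)| ≤ u |p(x)| + ((1 + u)^{2n} - 1)² · p̃(|x|)`.
Proof as printed: `res - p(x) = η p(x) + (1 + η)(ĉ - c)` by eq. (10), then Lemma 1 and eq. (11).
[cite: LangloisLouvet2006, §3.1 Theorem 4 eq. (12)] -/
theorem abs_compHornerRes_sub_sum_le {u : K} (hu : 0 ≤ u) (x : K) (n : ℕ)
    (a s p π σ τ ε δ : ℕ → K) (η : K) (hsn : s n = a n)
    (hprod : ∀ i < n, s (i + 1) * x = p i + π i) (hsum : ∀ i < n, p i + a i = s i + σ i)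
    (hπ : ∀ i < n, |π i| ≤ u * |s (i + 1) * x|) (hσ : ∀ i < n, |σ i| ≤ u * |p i + a i|)
    (hτ : ∀ k, |τ k| ≤ u) (hε : ∀ k, |ε k| ≤ u) (hδ : ∀ k, |δ k| ≤ u) (hη : |η| ≤ u) :
    |compHornerRes x (s 0) π σ τ ε δ η n - ∑ i ∈ range (n + 1), a i * x ^ i|
      ≤ u * |∑ i ∈ range (n + 1), a i * x ^ i|
        + ((1 + u) ^ (2 * n) - 1) ^ 2 * ∑ i ∈ range (n + 1), |a i| * |x| ^ i := by
  set P := ∑ i ∈ range (n + 1), a i * x ^ i with hP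
  set S := ∑ i ∈ range (n + 1), |a i| * |x| ^ i with hS
  set c := ∑ i ∈ range n, (π i + σ i) * x ^ i with hc
  set chat := compHornerCorr x π σ τ ε δ n with hchat
  have hS0 : 0 ≤ S := Finset.sum_nonneg fun _ _ => by positivity
  have hq : 0 ≤ (1 + u) ^ (2 * n) - 1 := by
    have := one_le_pow₀ (M₀ := K) (a := 1 + u) (by linarith) (n := 2 * n); linarith
  have hid : s 0 + c = P := eftHorner_add_sum_eq x n a s p π σ hsn hprod hsum
  -- the correcting term: (1 + u)|ĉ - c| ≤ ((1+u)^{2n} - 1) Σ|πᵢ + σᵢ||x|ⁱ ≤ ((1+u)^{2n} - 1)² S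
  have hcorr : (1 + u) * |chat - c|
      ≤ ((1 + u) ^ (2 * n) - 1) * ∑ i ∈ range n, |π i + σ i| * |x| ^ i :=
    one_add_mul_abs_hornerFlTrunc_sub_sum_le hu x n (fun i => π i + σ i) τ ε δ hτ hε hδ
  have hct : ∑ i ∈ range n, |π i + σ i| * |x| ^ i ≤ ((1 + u) ^ (2 * n) - 1) * S :=
    le_trans (Finset.sum_le_sum fun i _ =>
        mul_le_mul_of_nonneg_right (abs_add_le _ _) (by positivity))
      (sum_abs_pi_add_abs_sigma_le hu x n a s p π σ hsn hprod hsum hπ hσ)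
  have hcorr' : (1 + u) * |chat - c| ≤ ((1 + u) ^ (2 * n) - 1) ^ 2 * S := by
    calc (1 + u) * |chat - c| ≤ ((1 + u) ^ (2 * n) - 1) * ∑ i ∈ range n, |π i + σ i| * |x| ^ i :=
          hcorr
      _ ≤ ((1 + u) ^ (2 * n) - 1) * (((1 + u) ^ (2 * n) - 1) * S) :=
          mul_le_mul_of_nonneg_left hct hq
      _ = ((1 + u) ^ (2 * n) - 1) ^ 2 * S := by ring
  -- the final addition
  have key : compHornerRes x (s 0) π σ τ ε δ η n - P = η * P + (1 + η) * (chat - c) := by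
    unfold compHornerRes
    rw [← hchat, ← hid]
    ring
  rw [key]
  have h1 : |η * P| ≤ u * |P| := by
    rw [abs_mul]; exact mul_le_mul_of_nonneg_right hη (abs_nonneg _)
  have h2 : |(1 + η) * (chat - c)| ≤ (1 + u) * |chat - c| := by
    have h1e : |1 + η| ≤ 1 + u := by
      have := abs_le.mp hη; rw [abs_le]; constructor <;> linarith
    rw [abs_mul]; exact mul_le_mul_of_nonneg_right h1e (abs_nonneg _)
  calc |η * P + (1 + η) * (chat - c)| ≤ u * |P| + (1 + u) * |chat - c| :=
        le_trans (abs_add_le _ _) (add_le_add h1 h2)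
    _ ≤ u * |P| + ((1 + u) ^ (2 * n) - 1) ^ 2 * S := add_le_add le_rfl hcorr'

/-- THEOREM 4, eq. (12) as printed: with `2n · u < 1`,
`|CompHorner(p, x) - p(x)| ≤ u |p(x)| + γ₂ₙ² p̃(|x|)`.
[cite: LangloisLouvet2006, §3.1 Theorem 4 eq. (12)]
[cite: GraillatJezequel2020, §6.2 Proposition 6.2] -/
theorem abs_compHornerRes_sub_sum_le_gamma {u : K} (hu : 0 ≤ u) {n : ℕ}
    (hn : ((2 * n : ℕ) : K) * u < 1) (x : K) (a s p π σ τ ε δ : ℕ → K) (η : K) (hsn : s n = a n)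
    (hprod : ∀ i < n, s (i + 1) * x = p i + π i) (hsum : ∀ i < n, p i + a i = s i + σ i)
    (hπ : ∀ i < n, |π i| ≤ u * |s (i + 1) * x|) (hσ : ∀ i < n, |σ i| ≤ u * |p i + a i|)
    (hτ : ∀ k, |τ k| ≤ u) (hε : ∀ k, |ε k| ≤ u) (hδ : ∀ k, |δ k| ≤ u) (hη : |η| ≤ u) :
    |compHornerRes x (s 0) π σ τ ε δ η n - ∑ i ∈ range (n + 1), a i * x ^ i|
      ≤ u * |∑ i ∈ range (n + 1), a i * x ^ i|
        + gamma u (2 * n) ^ 2 * ∑ i ∈ range (n + 1), |a i| * |x| ^ i := by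
  have hq : 0 ≤ (1 + u) ^ (2 * n) - 1 := by
    have := one_le_pow₀ (M₀ := K) (a := 1 + u) (by linarith) (n := 2 * n); linarith
  have hsq : ((1 + u) ^ (2 * n) - 1) ^ 2 ≤ gamma u (2 * n) ^ 2 :=
    pow_le_pow_left₀ hq (one_add_pow_sub_one_le_gamma hu hn) 2
  exact le_trans
    (abs_compHornerRes_sub_sum_le hu x n a s p π σ τ ε δ η hsn hprod hsum hπ hσ hτ hε hδ hη)
    (add_le_add le_rfl
      (mul_le_mul_of_nonneg_right hsq (Finset.sum_nonneg fun _ _ => by positivity)))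

/-- Eq. (14), relative form of Theorem 4: with `2n · u < 1`,
`|CompHorner(p, x) - p(x)| / |p(x)| ≤ u + γ₂ₙ² cond(p, x)` (`cond` = `Higham2002.condPoly`; for
`p(x) = 0` the left side is `0` by `y / 0 = 0` and the bound reads `0 ≤ u`).
[cite: LangloisLouvet2006, §3.1 eq. (14)] [cite: GraillatJezequel2020, §6.2 Proposition 6.2] -/
theorem abs_compHornerRes_sub_sum_div_le {u : K} (hu : 0 ≤ u) {n : ℕ}
    (hn : ((2 * n : ℕ) : K) * u < 1) (x : K) (a s p π σ τ ε δ : ℕ → K) (η : K) (hsn : s n = a n)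
    (hprod : ∀ i < n, s (i + 1) * x = p i + π i) (hsum : ∀ i < n, p i + a i = s i + σ i)
    (hπ : ∀ i < n, |π i| ≤ u * |s (i + 1) * x|) (hσ : ∀ i < n, |σ i| ≤ u * |p i + a i|)
    (hτ : ∀ k, |τ k| ≤ u) (hε : ∀ k, |ε k| ≤ u) (hδ : ∀ k, |δ k| ≤ u) (hη : |η| ≤ u) :
    |compHornerRes x (s 0) π σ τ ε δ η n - ∑ i ∈ range (n + 1), a i * x ^ i|
        / |∑ i ∈ range (n + 1), a i * x ^ i|
      ≤ u + gamma u (2 * n) ^ 2 * condPoly a x n := by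
  have h := abs_compHornerRes_sub_sum_le_gamma hu hn x a s p π σ τ ε δ η hsn hprod hsum hπ hσ
    hτ hε hδ hη
  set P := ∑ i ∈ range (n + 1), a i * x ^ i
  set S := ∑ i ∈ range (n + 1), |a i| * |x| ^ i
  unfold condPoly
  rcases eq_or_lt_of_le (abs_nonneg P) with hP | hP
  · rw [← hP]; simp [hu]
  · rw [div_le_iff₀ hP, add_mul, mul_assoc, div_mul_cancel₀ _ (ne_of_gt hP)]
    exact h

/-- REMARK 1, eq. (13): the correcting term alone satisfies `|ĉ - c| ≤ γ₂ₙ² p̃(|x|)` (`2n · u < 1`),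
`c = (p_π + p_σ)(x) = Σ_{i<n} (πᵢ + σᵢ) xⁱ`. [cite: LangloisLouvet2006, §3.1 Remark 1 eq. (13)] -/
theorem abs_compHornerCorr_sub_le_gamma_sq {u : K} (hu : 0 ≤ u) {n : ℕ}
    (hn : ((2 * n : ℕ) : K) * u < 1) (x : K) (a s p π σ τ ε δ : ℕ → K) (hsn : s n = a n)
    (hprod : ∀ i < n, s (i + 1) * x = p i + π i) (hsum : ∀ i < n, p i + a i = s i + σ i)
    (hπ : ∀ i < n, |π i| ≤ u * |s (i + 1) * x|) (hσ : ∀ i < n, |σ i| ≤ u * |p i + a i|)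
    (hτ : ∀ k, |τ k| ≤ u) (hε : ∀ k, |ε k| ≤ u) (hδ : ∀ k, |δ k| ≤ u) :
    |compHornerCorr x π σ τ ε δ n - ∑ i ∈ range n, (π i + σ i) * x ^ i|
      ≤ gamma u (2 * n) ^ 2 * ∑ i ∈ range (n + 1), |a i| * |x| ^ i := by
  set S := ∑ i ∈ range (n + 1), |a i| * |x| ^ i with hS
  set c := ∑ i ∈ range n, (π i + σ i) * x ^ i with hc
  have hS0 : 0 ≤ S := Finset.sum_nonneg fun _ _ => by positivity
  have hq : 0 ≤ (1 + u) ^ (2 * n) - 1 := by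
    have := one_le_pow₀ (M₀ := K) (a := 1 + u) (by linarith) (n := 2 * n); linarith
  have hcorr : (1 + u) * |compHornerCorr x π σ τ ε δ n - c|
      ≤ ((1 + u) ^ (2 * n) - 1) * ∑ i ∈ range n, |π i + σ i| * |x| ^ i :=
    one_add_mul_abs_hornerFlTrunc_sub_sum_le hu x n (fun i => π i + σ i) τ ε δ hτ hε hδ
  have hct : ∑ i ∈ range n, |π i + σ i| * |x| ^ i ≤ ((1 + u) ^ (2 * n) - 1) * S :=
    le_trans (Finset.sum_le_sum fun i _ =>
        mul_le_mul_of_nonneg_right (abs_add_le _ _) (by positivity))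
      (sum_abs_pi_add_abs_sigma_le hu x n a s p π σ hsn hprod hsum hπ hσ)
  have hsq : ((1 + u) ^ (2 * n) - 1) ^ 2 ≤ gamma u (2 * n) ^ 2 :=
    pow_le_pow_left₀ hq (one_add_pow_sub_one_le_gamma hu hn) 2
  have habs := abs_nonneg (compHornerCorr x π σ τ ε δ n - c)
  calc |compHornerCorr x π σ τ ε δ n - c| ≤ (1 + u) * |compHornerCorr x π σ τ ε δ n - c| :=
        le_mul_of_one_le_left habs (by linarith)
    _ ≤ ((1 + u) ^ (2 * n) - 1) * (((1 + u) ^ (2 * n) - 1) * S) :=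
        le_trans hcorr (mul_le_mul_of_nonneg_left hct hq)
    _ = ((1 + u) ^ (2 * n) - 1) ^ 2 * S := by ring
    _ ≤ gamma u (2 * n) ^ 2 * S := mul_le_mul_of_nonneg_right hsq hS0

/-! ## Theorem 7 (a priori criterion for faithful rounding): the real-arithmetic core -/

/-- THEOREM 7, the inequality it rests on (model form). If `2n · u < 1`, `p(x) ≠ 0` and the
A PRIORI CRITERION eq. (15) holds, `cond(p, x) < (1 - u)/(2 + u) · u · γ₂ₙ⁻²`, then the correcting
term is accurate to `|ĉ - c| < (u/2) · |res|` — the hypothesis of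
[LangloisLouvet2006, §3.2 Lemma 6], from which Lemma 5 (Rump–Ogita–Oishi; a statement about the
FORMAT, not made here) concludes that `res = CompHorner(p, x)` is a faithful rounding of `p(x)`.
Steps as printed: eq. (16) `(1 - u)|p(x)| - γ₂ₙ² p̃ ≤ |res|` from eq. (12); eq. (15) ⟺
`γ₂ₙ² p̃ < (u/2)[(1 - u)|p(x)| - γ₂ₙ² p̃]`; then eq. (13). (For `p(x) = 0` the print's `cond` is
`+∞` and eq. (15) fails; Lean's `condPoly` would be `0`, hence the explicit hypothesis. For `n = 0`
the print's `γ₀⁻² = +∞` is Lean's junk `x / 0 = 0`, so the hypothesis is then unsatisfiable and the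
statement vacuous — a degree-`0` evaluation has no correcting term anyway.)
[cite: LangloisLouvet2006, §3.2 Theorem 7 eq. (15)–(16)] -/
theorem abs_compHornerCorr_sub_lt_of_cond_lt {u : K} (hu : 0 ≤ u) {n : ℕ}
    (hn : ((2 * n : ℕ) : K) * u < 1) (x : K) (a s p π σ τ ε δ : ℕ → K) (η : K) (hsn : s n = a n)
    (hprod : ∀ i < n, s (i + 1) * x = p i + π i) (hsum : ∀ i < n, p i + a i = s i + σ i)
    (hπ : ∀ i < n, |π i| ≤ u * |s (i + 1) * x|) (hσ : ∀ i < n, |σ i| ≤ u * |p i + a i|)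
    (hτ : ∀ k, |τ k| ≤ u) (hε : ∀ k, |ε k| ≤ u) (hδ : ∀ k, |δ k| ≤ u) (hη : |η| ≤ u)
    (hp0 : ∑ i ∈ range (n + 1), a i * x ^ i ≠ 0)
    (hcond : condPoly a x n < (1 - u) / (2 + u) * u / gamma u (2 * n) ^ 2) :
    |compHornerCorr x π σ τ ε δ n - ∑ i ∈ range n, (π i + σ i) * x ^ i|
      < u / 2 * |compHornerRes x (s 0) π σ τ ε δ η n| := by
  set P := ∑ i ∈ range (n + 1), a i * x ^ i with hP
  set S := ∑ i ∈ range (n + 1), |a i| * |x| ^ i with hS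
  set c := ∑ i ∈ range n, (π i + σ i) * x ^ i with hc
  set G := gamma u (2 * n) ^ 2 with hG
  set res := compHornerRes x (s 0) π σ τ ε δ η n with hres
  have hPpos : 0 < |P| := abs_pos.mpr hp0
  have hS0 : 0 ≤ S := Finset.sum_nonneg fun _ _ => by positivity
  have hG0 : 0 ≤ G := sq_nonneg _
  have h2u : 0 < 2 + u := by linarith
  -- eq. (15) multiplied out: (2 + u) · G · S < (1 - u) · u · |P|
  have hcrit : (2 + u) * G * S < (1 - u) * u * |P| := by
    have hcond' : S / |P| < (1 - u) / (2 + u) * u / G := hcond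
    rcases eq_or_lt_of_le hG0 with hG00 | hGpos
    · exfalso
      rw [← hG00, div_zero] at hcond'
      exact absurd hcond' (not_lt.mpr (div_nonneg hS0 (le_of_lt hPpos)))
    · have h1 : S < (1 - u) / (2 + u) * u / G * |P| := (div_lt_iff₀ hPpos).mp hcond'
      have h2 : S * G < (1 - u) / (2 + u) * u * |P| := by
        rw [div_mul_eq_mul_div] at h1
        exact (lt_div_iff₀ hGpos).mp h1
      have h3 : S * G * (2 + u) < (1 - u) * u * |P| := by
        rw [show (1 - u) / (2 + u) * u * |P| = (1 - u) * u * |P| / (2 + u) by ring] at h2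
        exact (lt_div_iff₀ h2u).mp h2
      linarith
  -- eq. (12) and eq. (16)
  have h12 : |res - P| ≤ u * |P| + G * S :=
    abs_compHornerRes_sub_sum_le_gamma hu hn x a s p π σ τ ε δ η hsn hprod hsum hπ hσ hτ hε hδ hη
  have h16 : (1 - u) * |P| - G * S ≤ |res| := by
    have := abs_sub_abs_le_abs_sub P res
    rw [abs_sub_comm] at this
    linarith
  -- eq. (13)
  have h13 : |compHornerCorr x π σ τ ε δ n - c| ≤ G * S :=
    abs_compHornerCorr_sub_le_gamma_sq hu hn x a s p π σ τ ε δ hsn hprod hsum hπ hσ hτ hε hδ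
  calc |compHornerCorr x π σ τ ε δ n - c| ≤ G * S := h13
    _ < u / 2 * ((1 - u) * |P| - G * S) := by linarith
    _ ≤ u / 2 * |res| := mul_le_mul_of_nonneg_left h16 (by linarith)

/-! ## Theorem 9 (dynamic bound): the starting inequality, eq. (18) -/

/-- REMARK 2 eq. (18) and the proof of THEOREM 9 (exact form): if the final addition is itself
performed as an EFT, `[res, e] = TwoSum(s₀, ĉ)` so that `res + e = s₀ + ĉ` exactly, then by eq. (10)
`|res - p(x)| = |ĉ - c - e| ≤ |ĉ - c| + |e|` — valid for ANY computed correcting term `ĉ`; the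
printed dynamic bound `β̂` of eq. (19) then bounds the two terms in floating point (NOT HERE).
[cite: LangloisLouvet2006, §4 Remark 2 eq. (18), proof of Theorem 9] -/
theorem abs_res_sub_sum_le_of_twoSum (x : K) (n : ℕ) (a s p π σ : ℕ → K) (chat res e : K)
    (hsn : s n = a n) (hprod : ∀ i < n, s (i + 1) * x = p i + π i)
    (hsum : ∀ i < n, p i + a i = s i + σ i) (he : res + e = s 0 + chat) :
    |res - ∑ i ∈ range (n + 1), a i * x ^ i|
      ≤ |chat - ∑ i ∈ range n, (π i + σ i) * x ^ i| + |e| := by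
  have hid := eftHorner_add_sum_eq x n a s p π σ hsn hprod hsum
  rw [show res - ∑ i ∈ range (n + 1), a i * x ^ i
      = (chat - ∑ i ∈ range n, (π i + σ i) * x ^ i) - e by linear_combination he + hid]
  exact abs_sub _ _

end Literature.ComputerArithmetic.LangloisLouvet2006
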